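import Mathlib
import HarnessLib
import HarnessLib.Audit
import Summits.MatrixMultiplication.Statement
import Literature.Computability.AlgebraicComplexity.MatrixMultiplicationExponent
import Literature.Computability.AlgebraicComplexity.WaringRankTrCube
import Literature.Computability.AlgebraicComplexity.WaringRankTrCubeProofs
import Literature.Computability.AlgebraicComplexity.FlatteningBound
import Summits.MatrixMultiplication.MatrixMultiplication.Theorems.AsymptoticRankCWOmegaGeTwo
import HarnessLib.Audit.Status.Attr

/-!
Route: WaringApolarity

DORMANT since 2026-08-21T11:51:55Z (reconciler: no traction for 5 d (last activity statement-closed at 2026-08-16T11:17:11Z); parked, not closed — `ledger route dormant route-MatrixMultiplication-WaringApolarity --off` to reactivate) — unstaffed, not closed; items shared with open routes are served there. `ledger route dormant <id> --off` reactivates.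

X_E (Waring-rank form of ω = 2): the cubic form sM⟨n⟩(A) = tr(A^3) on n × n complex matrices has
Waring (symmetric)
rank n^{2+o(1)}: for every ε > 0, R_S(tr(A^3) on M_n(ℂ)) = O(n^{2+ε}), where R_S(P) = least r with P
= Σ_{i<r} ℓ_i^3,
ℓ_i linear forms (here ℓ_i(A) = tr(L_i A)). By ChiantiniHauensteinIkenmeyerLandsbergOttaviani2018
(arXiv:1706.05074)
Thm 1.1, ω = liminf_n log_n R_S(sM⟨n⟩) = liminf_n log_n bR_S(sM⟨n⟩); the direction used for the
summit is elementary: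
tr(X^3) = 3 tr(ABC) for the 3n × 3n block matrix X(A,B,C) (their p5), so a length-r Waring
decomposition on M_{3n} yields
R(⟨n,n,n⟩) ≤ r by polarisation (char 0), and conversely R_S(sM⟨n⟩) ≤ 4 R(⟨n,n,n⟩) (Waring rank of
xyz is 4).

Lean (elaborates, Sketch.lean; Waring rank inlined as an sInf, no new definition needed for the
thesis):
∀ ε : ℝ, 0 < ε → (fun n : ℕ => ((sInf {r : ℕ | ∃ (L : Fin r → Matrix (Fin n) (Fin n) ℂ), ∀ A :
Matrix (Fin n) (Fin n) ℂ, (A ^ 3).trace = ∑ i, ((L i * A).trace) ^ 3} : ℕ) : ℝ)) =O[Filter.atTop]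
fun n : ℕ => (n : ℝ) ^ (2 + ε)

Rationale: WHY THIS LINE. (widen: commutative algebra / classical algebraic geometry of ONE cubic hypersurface
per n)
ChiantiniHauensteinIkenmeyerLandsbergOttaviani2018 (arXiv:1706.05074, Thm 1.1; its first equality
ω = lim_n log_n R_S(sM⟨n⟩) is PROVED in tree:
WaringRankTrCubeProofs.CHILO2018_omega_eq_liminf_holds) show that ω is
computed by the Waring rank of the single cubic tr(A^3) ∈ Sym^3(M_n^*). This trades 3-tensors under
GL_{n^2}^{×3} for
cubic forms under GL_{n^2}, where a different toolbox applies: apolarity (the apolar ideal tr(A^3)^⊥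
⊂ Sym(M_n)),
catalecticants and Young flattenings of symmetric tensors, Buczyńska–Buczyński border apolarity
(arXiv:1910.01944;
algorithmic form ConnerHarperLandsberg2023, arXiv:1911.07981), and Reznick/design-type constructions
of SHORT power-sum
decompositions from finite group orbits — tr(A^3) is invariant under A ↦ gAg⁻¹ and transposition
(SymmetrizedMatMul.lean, proved), so a Waring decomposition is a weighted "cubic 3-design" {L_i};
the instances that
exist are orbit designs: Conner2019 (arXiv:1711.05796, Thm 1–2: sM⟨3⟩, 18 cubes, symmetry (Z_3^2 ⋊
SL_2(F_3)) ⋊ Z_2)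
and the cube-group decomposition of sM⟨4⟩ with 40 cubes (Landsberg2018Developments arXiv:1811.11667
p.2, "Third idea":
Conner's programme Γ_n ⊂ PGL_n ⋊ Z_2). Imported from outside the summit's cone: symmetric-tensor
rank theory and
finite-group design theory; nothing from the laser/group-theoretic toolboxes. DECIDING THEOREM (rev
3, proved):
closes (hE : EThesis) : MatrixMultiplication — ω ≥ 2 by FlatteningBound.omega_two_le, ω ≤ 2 by
contradiction from
X_E at ε = (ω−2)/2 against WaringRankTrCubeProofs.rpow_omega_le_waringRankTrCube ((n/4)^ω ≤
R_S(sM⟨n⟩), n ≥ 6);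
so the route decides the summit from its target alone, and the frame supports (EPolarisationBridge,
EWaringLeFourRank, AMonotone, OmegaGeTwo, Assembly := EThesis → MatrixMultiplication) are one-liners
over landed
Literature theorems.

RANKED CRUXES.
#2 EOrbitDesigns (crux) — ORBIT-DESIGN CONSTRUCTION, the typed "trace-cube design": ∀ε>0 ∃C, for all
large n a FINITE
Γ ≤ GL_n(ℂ) and a Waring decomposition tr(A^3) = Σ_{i<r} tr(L_i A)^3, r ≤ C·n^{2+ε}, whose term set
is Γ-stable
under conjugation up to cube roots of unity and meets ≤ C·n^ε Γ-orbits (why it might fail: strictly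
stronger than
ω = 2 — few orbits force |Γ_n| ≥ n²/C and an overdetermined cubic-moment system on ≤ C·n^{2+ε} seed
parameters; only
n ≤ 4 instances exist, of size n²(n+1)/2, exponent 3; CHILO2018 Prop. p.5 forces some L_i of rank ≥
3; the Clifford
family is already dead by the support items ECliffordOrbitFloor / EAffordableSeedsNoGo if they hold;
sources:
Conner2019 Thm 1–2, Landsberg2018Developments p.2, CHILO2018 §2 p.5). Feeds the target through the
support glue
EOrbitDesignsToThesis (forget Γ, absorb C at ε/2, waringRankTrCube_le).
#5 EBorderApolaritySM3 (crux) — waringRankTrCube 3 = 18, the first data point of the symmetric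
exponent beyond n = 2
(why it might fail: = CHILO2018 Conj. 2.8, OPEN; ≤ 18 is Conner2019 Thm 1, an exact certificate over
ℚ(ζ_3); ≥ 18 is
open — only bR_S ≥ 14 by Young flattenings, and linear rank methods are capped at ~8N on cubic
formats
(Literature.Barriers.MatrixMultiplication.LinearRankMethodBarrier;
RankMethodBarriersWaring.EGOW2018_thm42_holds,
ApolarityBound.rank_le_mul_rank_hankel, both proved), so ≥ 18 needs apolarity/substitution or border
apolarity; the
true value may be 15–17; sources: CHILO2018 Thm 1.3(2), Thm* 1.4, Conj. 2.8; Conner2019 Thm 1;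
BuczynskaBuczynski2021;
template WaringRankTrCubeTwo.lean (n = 2: R_S = 6, proved by certificate + Landsberg–Teitler
bound)).
Target #0 EThesis (X_E) and supports: ETraceCubeDesigns (≡ X_E at ε/2, the untyped existence form),
EPolarisationBridge
(= WaringRankTrCubeProofs.tensorRank_matMulTensor_le_of_waring), EWaringLeFourRank (=
CHILO2018_waringRank_le_holds),
AMonotone (= Theorems/AsymptoticSpectrumMonotone), OmegaGeTwo (= FlatteningBound),
EOrbitDesignsToThesis (glue),
EAffordableSeedsNoGo and ECliffordOrbitFloor (negative knowledge for #2: the k-qudit Clifford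
groups, the only Γ_n with
instances, cost ≥ c_p·n^4 terms), Assembly (= the type of `closes`).

KILL CRITERIA. X_E ⟺ ω(ℂ) = 2 is formal in tree (closes one way;
TensorRestrictionRank.exists_tensorRank_matMulTensor_le_rpow
(R(⟨n,n,n⟩) ≤ C_δ·n^{ω+δ}) + EWaringLeFourRank the other), so the THESIS dies only with the summit:
a proof of ¬EThesis, e.g. bR_S(sM⟨n⟩) ≥ c·n^{2+δ} along a
sequence (which needs a non-linear-rank method: LinearRankMethodBarrier, EGOW Thm 4.2/4.4), closes
every positive route
of MatrixMultiplication at once and should be filed as ¬EThesis if evidence appears. The LINE (orbit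
designs) dies
earlier and cheaper: a representation-theoretic lower bound "every Γ-stable Waring decomposition of
tr(A^3) with
≤ C·n^ε orbits has ≥ n^{2+c} terms" for ALL finite Γ ≤ GL_n refutes #2 (¬EOrbitDesigns) and sends
the route back to
unstructured X_E (then: close as exhausted unless a non-orbit construction idea exists);
ECliffordOrbitFloor proved
re-ranks only (Clifford family out, monomial / PGL_2(q) / wreath-product families next).

NOT DECOMPOSED YET. The choice of Γ_n beyond the Heisenberg/Clifford family (monomial ±1-groups,
PGL_2(q) in its
n = q±1 representations, wreath products S_m ≀ Γ_{n/m}); the split of #2 into (a) "Γ_n with dim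
Sym^3(M_n^*)^{Γ_n} ≤
C·n^ε exists with tr(A^3) in the span of ≤ C·n^ε orbit cubic moments" and (b) the character
computation solving the
moment equations — to be glued only after ECliffordOrbitFloor / EAffordableSeedsNoGo close and name
the surviving
families; generators of the apolar ideal tr(A^3)^⊥ (needed for the ≥ 18 half of #5); a
borderWaringRank notion in Lean
(#5's informal text asks for bR_S(sM⟨3⟩) too, the signature pins R_S only); the relation to route
GroupTheoreticSTPP
(group orbits again, but acting on ONE matrix space instead of three).

CHEAPEST FALSIFIER. For the line: the Clifford-orbit floor (support ECliffordOrbitFloor, an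
elementary orbit-counting
argument: every non-affordable seed has a Clifford orbit of size ≥ c·n^4) together with
EAffordableSeedsNoGo at the
smallest new cases (p,k) = (2,2), (5,1), (2,3) — a finite linear-algebra check in Sym^3(M_n)^Γ that
`kit` can certify
(does tr(A^3) lie in the span of the cubic moments of the two affordable seed families?). A "no" at
n = 4, 5, 8 kills the
only family with instances and forces the pivot named under KILL CRITERIA; nothing cheap can kill
X_E itself (it is
ω = 2).

Novelty: NOVELTY (retriage pass 2026-08-14; searched: `lit citing arXiv:1706.05074` (38 citing works, local
graph), `lit search "symmetrized matrix multiplication tensor Waring rank"` (local store + Crossref;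
OpenAlex/S2/arXiv APIs rate-limited this pass), `lit read` of every hit named below).
Nearest prior art:
(1) ChiantiniHauensteinIkenmeyerLandsbergOttaviani2018 (arXiv:1706.05074) — the whole "polynomial
path": Thm 1.1 (ω = liminf_n log_n R_S(sM⟨n⟩) = liminf_n log_n bR_S(sM⟨n⟩)), Lemma 1.2 (R_S(S(t)) ≤
4 R(t)), the 3n × 3n block polarisation (§2, p.5), Thm 1.3 (R_S(sM⟨2⟩) = 6, bR_S(sM⟨2⟩) = 5,
bR_S(sM⟨3⟩) ≥ 14), Theorem* 1.4 (R_S(sM⟨3⟩) ≤ 18 numerically) and Conj. 2.8 (R_S(sM⟨3⟩) = 18). The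
thesis X_E, both bridge items and the n = 3 item are theirs.
(2) Conner2019 (arXiv:1711.05796, Thm 1–2) — an EXACT rank-18 Waring decomposition of sM⟨3⟩: the 9
Heisenberg–Weyl (clock/shift) matrices plus 9 rank-one matrices indexed by the affine plane AG(2,3),
symmetry group (Z_3^2 ⋊ SL(2,F_3)) ⋊ Z_2 of order 432, "which I hope will lead to generalizations to
larger n"; and Landsberg2018Developments (arXiv:1811.11667, p.2, "Third idea") — Conner's programme:
find sequences of finite groups Γ_n ⊂ G_{sM⟨n⟩} = PGL_n ⋊ Z_2 such that the Γ_n-invariant cubics on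
M_n all have low Waring rank ("in the spirit of, but very different from, Cohn–Umans"), with
R_S(sM⟨4⟩) ≤ 40 (cube symmetry). The rank-2 crux ETraceCubeDesigns (orbit designs under finite Γ_n ≤
GL_n acting by conjugation ± transpose, Heisenbe  [refs: 1706.05074, 1711.05796, 1811.11667, 1910.01944, 1911.07981, 2401.07631, 1909.04785, Conner2019, BuczynskaBuczynski2021, ConnerHarperLandsberg2023, DuttaGesmundoIkenmeyerJindalLysikov2024, ConnerGesmundoLandsbergVentura2022]

Barriers (technique_class: waring-rank, border-apolarity, symmetry-orbit-design): BARRIERS (catalogue lean/Literature/Barriers/MatrixMultiplication, all 12 entries read 2026-08-14).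
technique_class: waring-rank, border-apolarity, symmetry-orbit-design.
- Literature.Barriers.MatrixMultiplication.LinearRankMethodBarrier (Buczynski2026 Thm 2 cactus
barrier ∧ EfremenkoGargOliveiraWigderson2018 Thm 4.4): APPLIES to the refutation side and to the
lower half of crux EBorderApolaritySM3. Matrices of linear forms (flattenings, catalecticants,
Koszul/Young flattenings) certify at most k(6m − 4) on C^m⊗C^m⊗C^m and ≤ 8N on cubic formats — never
n^{2+δ} — so the route's own kill criterion "bR_S(sM⟨n⟩) ≥ c·n^{2+δ}" cannot be met inside that
class, and at n = 3 the Young-flattening bound 14 (CHILO2018 Thm 1.3) is where the class stalled.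
Evasion: the n = 3 item is a WARING-rank (not border-rank) equality, attackable by
apolarity/substitution arguments on the apolar ideal of tr(A^3) and by Buczyńska–Buczyński border
apolarity (BuczynskaBuczynski2021; ConnerHarperLandsberg2023), which is not a linear rank method;
whether border apolarity is itself cactus-bounded is open (Buczynski2026 §1.5), so the evasion is a
bet, not a theorem. The constructive items (upper bounds) are untouched.
- Literature.Barriers.MatrixMultiplication.InfimumNotMinimumBarrier (CoppersmithWinograd1982 strict
asymptotic sum inequality): one Waring decomposition of sM⟨3m⟩ of length r gives only R(⟨m,m,m⟩) ≤
r, hence ω < log_m r strictly — no single design certifies ω = 2. Respected rather than evaded: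

History (route lifecycle, newest last):
- 2026-08-15T16:17:50Z · rev 4: restated Assembly (stmt-MatrixMultiplication-0617) — route-repair (glue): the gate refuses --drop on the assembly item, so RESTATE it by name — Assembly := EThesis → _root_.MatrixMultiplication (was: the inlined E (planner-rbadge-MatrixMultiplication-WaringApol-21388bfa-g2-0)
- 2026-08-16T04:11:35Z · AUTO-CRUX (backfill): EThesis — hypotheses of the deciding theorem that nothing in the route derives are cruxes (operator:999:1085951)
- 2026-08-21T11:51:55Z · DORMANT — reconciler: no traction for 5 d (last activity statement-closed at 2026-08-16T11:17:11Z); parked, not closed — `ledger route dormant route-MatrixMultiplication- (operator:999:1667300)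

sub-problem: MatrixMultiplication · status: dormant · opened planner-MatrixMultiplication-Survey-0 2026-08-13T13:21:27Z · rev 5 · ledger route-MatrixMultiplication-WaringApolarity
GENERATED by the gate from the ledger (D-0016/17). Provers cite these decls: `theorem foo : Summit.MatrixMultiplication.MatrixMultiplication.Theses.WaringApolarity.<Decl> := …` in Summits/MatrixMultiplication/MatrixMultiplication/Theorems/<Name>.lean.
-/

namespace Summit.MatrixMultiplication.MatrixMultiplication.Theses.WaringApolarity

open scoped BigOperators Topology Manifold Classical MeasureTheory ProbabilityTheory Matrix InnerProductSpace ComplexConjugate ContinuousMap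
open Filter Set Function TopologicalSpace MeasureTheory

attribute [summit_statement] _root_.MatrixMultiplication

/-- item stmt-MatrixMultiplication-0616 · crux (kind.auto-crux: conjecture-grade) · rank 0 · open · by planner
why it might fail: Equivalent to ω(ℂ)=2 (CHILO2018 Thm 1.1 + Lemma 1.2 + p.5 bridge), so exactly as hard as the summit and false if ω>2; best known ω<2.3714; every method in use is barred above 2 (Alman2021: ω_u(CW_q)≥2.16805); known R_S(sM⟨n⟩) data 6,18,40 (n=2,3,4) = n²(n+1)/2, exponent-3 growth.
sources: ChiantiniHauensteinIkenmeyerLandsbergOttaviani2018, Thm 1.1 / Lemma 1.2 / §2 p.5 (arXiv:1706.05074), AlmanDuanVassilevskaWilliamsXuXuZhou2025 (ω < 2.371339), Alman2021, Thm 1.3 (Literature.Barriers.MatrixMultiplication.UniversalMethodBarrier), Conner2019, Thm 1 (arXiv:1711.05796); Landsberg2018Developments, p.2 (arXiv:1811.11667): R_S(sM⟨3⟩) ≤ 18, R_S(sM⟨4⟩) ≤ 40, Literature/Computability/AlgebraicComplexity/WaringRankTrCubeProofs.lean: CHILO2018_omega_eq_liminf_holds, tendsto_logb_waringRankTrCube,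 rpow_omega_le_waringRankTrCube (Thm 1.1 first equality PROVED in tree; EThesis ⟺ ω(ℂ)=2 is formal modulo the two frame items)
X_E: Waring rank of the cubic tr(A^3) on M_n(ℂ) is n^{2+o(1)}: for every ε>0, min{r | tr(A^3) =
Σ_{i<r} tr(L_i A)^3 identically} = O(n^{2+ε}) (CHILO2018 Thm 1.1: this liminf-exponent equals ω). -/
@[route_item "route-MatrixMultiplication-WaringApolarity", crux]
def EThesis : Prop :=
  ∀ ε : ℝ, 0 < ε → (fun n : ℕ => ((sInf {r : ℕ | ∃ (L : Fin r → Matrix (Fin n) (Fin n) ℂ), ∀ A : Matrix (Fin n) (Fin n) ℂ, (A ^ 3).trace = ∑ i, ((L i * A).trace) ^ 3} : ℕ) : ℝ)) =O[Filter.atTop] fun n : ℕ => (n : ℝ) ^ (2 + ε)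

/-- item stmt-MatrixMultiplication-1142 · crux · rank 2 · open · by planner
why it might fail: Strictly stronger than ω=2: few orbits force |Γ_n| ≥ n²/C and an overdetermined cubic-moment system on ≤ C·n^{2+ε} seed parameters; only n ≤ 4 instances exist (6, 18, 40 = n²(n+1)/2 terms: exponent 3); CHILO2018 Prop. p.5: some L_i has rank ≥ 3 (n ≥ 3), so rank-one orbit designs fail.
sources: Conner2019, Thm 1–2 (arXiv:1711.05796 p.2): rank-18 Waring decomposition of sM⟨3⟩ = 9 Heisenberg–Weyl + 9 rank-one matrices; symmetry group (Z_3^2 ⋊ SL(2,F_3)) ⋊ Z_2 of order 432, preserving {m_i} up to powers of ζ; stabiliser of sM⟨n⟩ is PGL(V) ⋊ Z_2, Landsberg2018Developments, p.2 'Third idea' (arXiv:1811.11667): Conner's programme — explicit sequences of finite groups Γ_n ⊂ G_{sM⟨n⟩} whose invariant cubics have low Waring rank; R_S(sM⟨4⟩) ≤ 40 with the symmetry group of the cube, ChiantiniHauensteinIkenmeyerLandsbergOttaviani2018, §2 p.5 (arXiv:1706.05074): Proposition (any Waring decomposition of sM⟨n⟩, n ≥ 3, has max_i rank L_i ≥ 3)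 and 'A modest upper bound' R_S(sM⟨n⟩) ≤ 8C(n,3)+4C(n,2)+n, Literature/Computability/AlgebraicComplexity/SymmetrizedMatMul.lean: symmetrizedMatMulPoly_conj_invariant', aeval_symmetrizedMatMulPoly_transpose (the conjugation/transpose invariance of tr(A^3), PROVED)
[crux] ORBIT-DESIGN CONSTRUCTION — the typed form of the posited 'trace-cube design'
(Conner–Landsberg programme: Landsberg2018Developments p.2 'Third idea'; instances Conner2019 Thm
1–2): for every ε>0 there is C such that for all large n there are a FINITE subgroup Γ ≤ GL_n(ℂ) and
a Waring decomposition tr(A^3) = Σ_{i<r} tr(L_i A)^3 with r ≤ C·n^{2+ε} whose set of terms is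
Γ-stable under conjugation up to cube roots of unity (g L_i g⁻¹ = ζ·L_{i'}, ζ^3 = 1 — the symmetry
notion of Conner2019 §1) and meets at most k ≤ C·n^ε Γ-orbits (every L_i is ζ·g L_{s_j} g⁻¹ for one
of k seeds s_j). STRICTLY STRONGER than EThesis/ETraceCubeDesigns: symmetrising an arbitrary
length-r decomposition over Γ costs |Γ|·r terms, so few orbits cannot be bought; with few orbits the
identity reduces to k cubic-moment equations in Sym^3(M_n^*)^Γ (a character computation). Instances:
n=3, r=18, k=2 (9 Heisenberg–Weyl + 9 rank-one matrices) under Z_3^2⋊SL_2(F_3) (Conner2019); n=4,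
r=40, cube group (Landsberg2018Developments p.2). The transposition half of G_{sM⟨n⟩} = PGL_n ⋊ Z_2
is deliberately omitted (it changes k by a factor ≤ 2). Feeds the thesis through the glue item
EOrbitDesignsToThesis. Candidate fa -/
@[route_item "route-MatrixMultiplication-WaringApolarity"]
def EOrbitDesigns : Prop :=
  ∀ ε : ℝ, 0 < ε → ∃ C : ℝ, ∀ᶠ n : ℕ in Filter.atTop, ∃ (G : Subgroup (GL (Fin n) ℂ)) (r k : ℕ) (L : Fin r → Matrix (Fin n) (Fin n) ℂ) (S : Fin k → Fin r), (G : Set (GL (Fin n) ℂ)).Finite ∧ (r : ℝ) ≤ C * (n : ℝ) ^ (2 + ε) ∧ (k : ℝ) ≤ C * (n : ℝ) ^ ε ∧ (∀ g ∈ G, ∀ i : Fin r, ∃ (i' : Fin r) (ζ : ℂ), ζ ^ 3 = 1 ∧ (g : Matrix (Fin n) (Fin n) ℂ) * L i * ((g⁻¹ : GL (Fin n) ℂ) : Matrix (Fin n) (Fin n) ℂ) = ζ • L i') ∧ (∀ i : Fin r, ∃ g ∈ G, ∃ (j : Fin k) (ζ : ℂ), ζ ^ 3 = 1 ∧ L i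 = ζ • ((g : Matrix (Fin n) (Fin n) ℂ) * L (S j) * ((g⁻¹ : GL (Fin n) ℂ) : Matrix (Fin n) (Fin n) ℂ))) ∧ ∀ A : Matrix (Fin n) (Fin n) ℂ, (A ^ 3).trace = ∑ i, ((L i * A).trace) ^ 3

/-- item stmt-MatrixMultiplication-0623 · crux · rank 5 · open · by planner
why it might fail: waringRankTrCube 3 = 18 is CHILO2018's OPEN Conj. 2.1 (journal 2.8). ≤ 18: exact certificate (Conner2019's 18 matrices over ℚ(ζ_3)). ≥ 18 is the open half: only bR_S ≥ 14 (Young flattening) is known and linear rank methods are capped (EGOW Thm 4.2, cactus barrier); the value may be 15–17.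
sources: ChiantiniHauensteinIkenmeyerLandsbergOttaviani2018, Thm 1.3(2) (bR_S(sM⟨3⟩) ≥ 14), Theorem* 1.4 and Conj. 2.8 (arXiv:1706.05074 p.4, p.6), Conner2019, Thm 1 (arXiv:1711.05796): R_S(sM⟨3⟩) ≤ 18 exactly, BuczynskaBuczynski2021 (border apolarity, arXiv:1910.01944); ConnerHarperLandsberg2023 (its algorithm, arXiv:1911.07981), Literature.Barriers.MatrixMultiplication.LinearRankMethodBarrier (Literature.Barriers.MatrixMultiplication.LinearRankMethodBarrier: Buczynski2026 Thm 2, EfremenkoGargOliveiraWigderson2018 Thm 4.4), Literature/Computability/AlgebraicComplexity/WaringRankTrCube.lean (Literature.Computability.AlgebraicComplexity.waringRankTrCube, CHILO2018_waringRank_two), Literature/Computability/AlgebraicComplexity/WaringRankTrCubeTwo.lean (PROVED n = 2 template): trCube_two_waringDecomposition (certificate by `ring`) and six_le_waringRankTrCube_two (Landsberg–Teitler-type lower bound via polarisation + nilpotent singular points)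
Certified computation crux: determine the Waring rank and border Waring rank of sM<3> = tr(A^3) on
M_3(ℂ) (9 variables; catalecticant lower bound 9; CHILO2018 Thm 1.3 covers only n = 2: R_S = 6, bR_S
= 5) using Buczyńska–Buczyński border apolarity (arXiv:1910.01944) / Gröbner certificates. Needs
waringRank, borderWaringRank definitions. -/
@[route_item "route-MatrixMultiplication-WaringApolarity"]
def EBorderApolaritySM3 : Prop :=
  Literature.Computability.AlgebraicComplexity.waringRankTrCube 3 = 18

/-- item stmt-MatrixMultiplication-0618 · support · rank 2 · open · by planner
why it might fail: As strong as ω=2 (CHILO2018 Thm 1.1): false if ω>2. The orbit designs that exist—Conner2019: sM⟨3⟩, 18 cubes, symmetry (Z₃²⋊SL₂(F₃))⋊Z₂; sM⟨4⟩, 40 cubes, cube group (Landsberg2018 p.2)—give 6,18,40 = n²(n+1)/2, exponent 3; no sequence Γ_n whose invariant cubics all have low Waring rank is known.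
sources: ChiantiniHauensteinIkenmeyerLandsbergOttaviani2018, Thm 1.1 and Prop. p.5 (n ≥ 3 ⇒ some L_i of rank ≥ 3) (arXiv:1706.05074), Conner2019, Thm 1–2 (arXiv:1711.05796): exact rank-18 decomposition of sM⟨3⟩ = 9 Heisenberg–Weyl matrices + 9 rank-one matrices, 432 symmetries, Landsberg2018Developments, p.2 'Third idea' (arXiv:1811.11667): Conner's programme Γ_n ⊂ G_{sM⟨n⟩}; R_S(sM⟨4⟩) ≤ 40
CONSTRUCTION crux (posited object "trace-cube design"): for every ε>0 and all large n there is a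
finite family (L_i)_{i<r} in M_n(ℂ) with r ≤ n^{2+ε} and Σ_i tr(L_i A)^3 = tr(A^3) for all A — to be
built from orbits of finite subgroups Γ_n ≤ GL_n(ℂ) (conjugation ± transpose) on seed matrices,
reducing the identity to a character computation in Sym^3(M_n)|Γ_n (Reznick-type designs;
Heisenberg/Clifford groups as first candidates). Interface (weighted family + cubic-moment identity)
and existence are separate statements; this item is the existence statement. -/
@[route_item "route-MatrixMultiplication-WaringApolarity"]
def ETraceCubeDesigns : Prop :=
  ∀ ε : ℝ, 0 < ε → ∀ᶠ n : ℕ in Filter.atTop, ∃ r : ℕ, (r : ℝ) ≤ (n : ℝ) ^ (2 + ε) ∧ ∃ L : Fin r → Matrix (Fin n) (Fin n) ℂ, ∀ A : Matrix (Fin n) (Fin n) ℂ, (A ^ 3).trace = ∑ i, ((L i * A).trace) ^ 3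

/-- item stmt-MatrixMultiplication-0619 · support · rank 3 · open · by planner
sources: ChiantiniHauensteinIkenmeyerLandsbergOttaviani2018, §2 proof of (1.6), p.5 (arXiv:1706.05074), Literature.Computability.AlgebraicComplexity.CHILO2018_rank_le_waringRank (+ .of_decomposition) in Literature/Computability/AlgebraicComplexity/WaringRankTrCube.lean, PROVED INGREDIENT (closes this item in one line, checked in planner Sketch2.lean): Literature.Computability.AlgebraicComplexity.tensorRank_matMulTensor_le_of_waring (WaringRankTrCubeProofs.lean, §Bridge): `fun n r ⟨L, hL⟩ => tensorRank_matMulTensor_le_of_waring L hL`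
Polarisation bridge (char 0): if tr(X^3) on M_{3n}(ℂ) has a Waring decomposition of length r,
tr(X^3) = Σ_{i<r} tr(L_i X)^3, then R(<n,n,n>) ≤ r (substitute the block matrix X(A,B,C) with X^3 =
diag(ABC,BCA,CAB), CHILO2018 p5, and take the ABC-multilinear component: tr(ABC) = 2 Σ_i
α_i(A)β_i(B)γ_i(C)). -/
@[route_item "route-MatrixMultiplication-WaringApolarity"]
def EPolarisationBridge : Prop :=
  ∀ n r : ℕ, (∃ (L : Fin r → Matrix (Fin (3 * n)) (Fin (3 * n)) ℂ), ∀ X : Matrix (Fin (3 * n)) (Fin (3 * n)) ℂ, (X ^ 3).trace = ∑ i, ((L i * X).trace) ^ 3) → Literature.Computability.AlgebraicComplexity.tensorRank (Literature.Computability.AlgebraicComplexity.matMulTensor ℂ n n n) ≤ r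

/-- item stmt-MatrixMultiplication-0621 · support · rank 4 · open · by planner
sources: ChiantiniHauensteinIkenmeyerLandsbergOttaviani2018, Lemma 1.2 (R_s(S(t)) ≤ 4 R(t); Waring rank of xyz is 4) (arXiv:1706.05074 p.4), Literature.Computability.AlgebraicComplexity.CHILO2018_waringRank_le in Literature/Computability/AlgebraicComplexity/WaringRankTrCube.lean, PROVED INGREDIENT (one line, checked in planner Sketch2.lean): Literature.Computability.AlgebraicComplexity.CHILO2018_waringRank_le_holds (WaringRankTrCubeProofs.lean, Part B); the item's sInf is `waringRankTrCube n` by rfl, so `fun n => CHILO2018_waringRank_le_holds n` closes it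
Converse up to a constant: the Waring rank of tr(A^3) on M_n(ℂ) is at most 4·R(<n,n,n>) (evaluate a
rank-R decomposition of <n,n,n> at (A,A,A) and use that a product of three linear forms is a sum of
4 cubes: 24xyz = (x+y+z)^3 − (x+y−z)^3 − (x−y+z)^3 + (x−y−z)^3). -/
@[route_item "route-MatrixMultiplication-WaringApolarity"]
def EWaringLeFourRank : Prop :=
  ∀ n : ℕ, sInf {r : ℕ | ∃ (L : Fin r → Matrix (Fin n) (Fin n) ℂ), ∀ A : Matrix (Fin n) (Fin n) ℂ, (A ^ 3).trace = ∑ i, ((L i * A).trace) ^ 3} ≤ 4 * Literature.Computability.AlgebraicComplexity.tensorRank (Literature.Computability.AlgebraicComplexity.matMulTensor ℂ n n n)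

/-- item stmt-MatrixMultiplication-0585 · support · rank 6 · open · by planner
sources: Blaser2013, §5 (zero-padding), Summits/MatrixMultiplication/MatrixMultiplication/Theorems/AsymptoticSpectrumMonotone.lean: tensorRank_matMulTensor_monotone (exact signature, sorry-free)
Monotonicity of matrix multiplication rank in the size over any field: n ≤ m → R(<n,n,n>) ≤
R(<m,m,m>) (<n,n,n> is a restriction of <m,m,m> by zero-padding; Blaser2013 §5). -/
@[route_item "route-MatrixMultiplication-WaringApolarity"]
def AMonotone : Prop :=
  ∀ (K : Type) [Field K] (n m : ℕ), n ≤ m → Literature.Computability.AlgebraicComplexity.tensorRank (Literature.Computability.AlgebraicComplexity.matMulTensor K n n n) ≤ Literature.Computability.AlgebraicComplexity.tensorRank (Literature.Computability.AlgebraicComplexity.matMulTensor K m m m)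

/-- item stmt-MatrixMultiplication-0586 · support · rank 6 · closed · proved by Summit.MatrixMultiplication.MatrixMultiplication.Theorems.omegaGeTwo_proof @ cbdcc04c67d9 (prover) · by planner
sources: Blaser2013, §6 (flattening bound R(⟨n,n,n⟩) ≥ n²), Summits/MatrixMultiplication/MatrixMultiplication/Theorems/AsymptoticSpectrumOmegaGeTwo.lean: omega_ge_two (exact signature, sorry-free), PROVED INGREDIENT (one line, checked in planner Sketch2.lean): Literature/Computability/AlgebraicComplexity/FlatteningBound.lean: admissibleExponents_bddBelow ℂ, omega_two_le ℂ — `⟨admissibleExponents_bddBelow ℂ, omega_two_le ℂ⟩`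
Lower frame shared by all positive routes: admissibleExponents ℂ is bounded below and 2 ≤ ω(ℂ), from
the flattening bound R(<n,n,n>) ≥ n^2 (Blaser2013 §5–6; BurgisserClausenShokrollahi1997 (15.?)
conciseness) and n^2 = O(n^β) ⇒ β ≥ 2. -/
@[route_item "route-MatrixMultiplication-WaringApolarity"]
def OmegaGeTwo : Prop :=
  BddBelow (Literature.Computability.AlgebraicComplexity.admissibleExponents ℂ) ∧ 2 ≤ Literature.Computability.AlgebraicComplexity.omega ℂ

/-- `OmegaGeTwo` holds: proved by `Summit.MatrixMultiplication.MatrixMultiplication.Theorems.omegaGeTwo_proof` @ cbdcc04c67d9. -/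
theorem OmegaGeTwo_holds : OmegaGeTwo := _root_.Summit.MatrixMultiplication.MatrixMultiplication.Theorems.omegaGeTwo_proof

/-- item stmt-MatrixMultiplication-1152 · support · rank 9 · open · by planner
sources: Literature/Computability/AlgebraicComplexity/WaringRankTrCube.lean: waringRankTrCube_le (a length-r decomposition bounds the sInf by r); the inlined sInf is waringRankTrCube n by rfl (planner Sketch2.lean)
[support] Glue EOrbitDesigns → EThesis (both statements inlined): forget Γ and the seeds; use the
hypothesis at ε/2 and absorb C (C·n^{2+ε/2} ≤ n^{2+ε} once n ≥ C^{2/ε}); a length-r decomposition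
bounds the sInf by r (Literature.Computability.AlgebraicComplexity.waringRankTrCube_le — the inlined
sInf is waringRankTrCube n by rfl); conclude IsBigO with constant 1 (norms of non-negative reals,
Real.rpow_le_rpow_of_exponent_le). Elementary. -/
@[route_item "route-MatrixMultiplication-WaringApolarity"]
def EOrbitDesignsToThesis : Prop :=
  (∀ ε : ℝ, 0 < ε → ∃ C : ℝ, ∀ᶠ n : ℕ in Filter.atTop, ∃ (G : Subgroup (GL (Fin n) ℂ)) (r k : ℕ) (L : Fin r → Matrix (Fin n) (Fin n) ℂ) (S : Fin k → Fin r), (G : Set (GL (Fin n) ℂ)).Finite ∧ (r : ℝ) ≤ C * (n : ℝ) ^ (2 + ε) ∧ (k : ℝ) ≤ C * (n : ℝ) ^ ε ∧ (∀ g ∈ G, ∀ i : Fin r, ∃ (i' : Fin r) (ζ : ℂ), ζ ^ 3 = 1 ∧ (g : Matrix (Fin n) (Fin n) ℂ) * L i * ((g⁻¹ : GL (Fin n) ℂ) : Matrix (Fin n) (Fin n) ℂ) = ζ • L i') ∧ (∀ i : Fin r, ∃ g ∈ G, ∃ (j : Fin k) (ζ : ℂ), ζ ^ 3 = 1 ∧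 L i = ζ • ((g : Matrix (Fin n) (Fin n) ℂ) * L (S j) * ((g⁻¹ : GL (Fin n) ℂ) : Matrix (Fin n) (Fin n) ℂ))) ∧ ∀ A : Matrix (Fin n) (Fin n) ℂ, (A ^ 3).trace = ∑ i, ((L i * A).trace) ^ 3) → (∀ ε : ℝ, 0 < ε → (fun n : ℕ => ((sInf {r : ℕ | ∃ (L : Fin r → Matrix (Fin n) (Fin n) ℂ), ∀ A : Matrix (Fin n) (Fin n) ℂ, (A ^ 3).trace = ∑ i, ((L i * A).trace) ^ 3} : ℕ) : ℝ)) =O[Filter.atTop] fun n : ℕ => (n : ℝ) ^ (2 + ε))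

/-- item stmt-MatrixMultiplication-7209 · support · rank 9 · open · by planner
[support][negative knowledge for crux EOrbitDesigns (stmt-1142) / ETraceCubeDesigns (stmt-0618);
filed from card no-free-lunch-unitary-3-designs-trace-cube by its plancard planner, 2026-08-15]
AFFORDABLE CLIFFORD SEEDS NEVER WORK AGAIN. n = p^k, indices Fin k → Fin p, Weyl operators W_{a,b} =
X^a Z^b inlined as Matrix.of (entry (x,y) = ω^{b·y}[x = y+a], ω = e^{2πi/p}), parity Π (entry [x =
−y]). Conner2019 Thm 1 (arXiv:1711.05796 p.2), read in the Weyl basis, is exactly: tr(A^3) on M_3 =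
cubes over {I − Π_α : α ∈ F_3^2} (the 9 rank-one 'affine plane' matrices = displaced parity line) ∪
{a·I} ∪ {8 Heisenberg–Weyl matrices}; i.e. every term is either a polynomial in ONE Weyl operator
(family 1: Σ_j f_j W_{a,b}^j) or on a displaced-parity line s·1 + t·Π·W_{a,b} (family 2). These two
families are precisely the seeds whose k-qudit Clifford conjugation orbits have O(n^2) elements
(every other orbit has ≥ c n^4, see ECliffordOrbitFloor), i.e. the only 'free' building blocks of
Clifford-symmetric trace-cube designs. CLAIM: for every prime p and k ≥ 1 with (p,k) ∉
{(2,1),(3,1)}, NO Waring decomposition of tr(A^3) on M_{p^k}(ℂ) has all its terms in family 1 ∪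
family 2 (any number of terms, a -/
@[route_item "route-MatrixMultiplication-WaringApolarity"]
def EAffordableSeedsNoGo : Prop :=
  ∀ p k : ℕ, p.Prime → 1 ≤ k → (p ≤ 3 → 2 ≤ k) → ∀ (r : ℕ) (L : Fin r → Matrix (Fin k → Fin p) (Fin k → Fin p) ℂ), (∀ i : Fin r, (∃ (a b : Fin k → Fin p) (f : Fin p → ℂ), L i = ∑ j : Fin p, f j • (Matrix.of fun x y : Fin k → Fin p => if x = y + a then Complex.exp (2 * (Real.pi : ℂ) * Complex.I * (∑ l : Fin k, ((b l : ℕ) : ℂ) * ((y l : ℕ) : ℂ)) / (p : ℂ)) else 0) ^ (j : ℕ)) ∨ (∃ (a b : Fin k → Fin p) (s t : ℂ), L i = s • (1 : Matrix (Fin k → Fin p) (Fin k → Fin p) ℂ) + t • ((Matrix.of fun x y : Fin k → Fin p => if x = -y then (1 : ℂ) else 0) * (Matrix.of fun x y : Fin k → Fin p => if x = y + a then Complex.exp (2 * (Real.pi : ℂ) * Complex.I * (∑ l : Fin k, ((b l : ℕ) : ℂ) * ((y l : ℕ) : ℂ)) / (p : ℂ)) else 0)))) → ¬ ∀ A : Matrix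 (Fin k → Fin p) (Fin k → Fin p) ℂ, (A ^ 3).trace = ∑ i, ((L i * A).trace) ^ 3

/-- item stmt-MatrixMultiplication-7262 · support · rank 9 · open · by planner
[support][negative knowledge for crux EOrbitDesigns (stmt-1142): the case Γ ⊇ Clifford group; card
no-free-lunch-unitary-3-designs-trace-cube main lemma + W3, extended to ALL primes; filed by its
plancard planner 2026-08-15] CLIFFORD-ORBIT FLOOR. Setting/inlined Weyl operators as in
EAffordableSeedsNoGo; the Clifford group is inlined as {U ∈ GL_n(ℂ) : ∀(a,b) ∃(a',b'), s: U W_{a,b}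
U⁻¹ = s·W_{a',b'}}. CLAIM: for every prime p there is c_p > 0 such that every Waring decomposition
tr(A^3) = Σ_{i<r} tr(L_i A)^3 on M_{p^k}(ℂ) (k ≥ 1) whose term set is Clifford-stable up to cube
roots of unity (U L_i U⁻¹ = ζ L_{i'}, ζ^3 = 1 — the symmetry notion of Conner2019 §1 and of
EOrbitDesigns) has r ≥ c_p·(p^k)^4. So Γ_n = (k-qudit) Clifford groups give exponent ≥ 4, worse than
the explicit ~(4/3)n^3 of CHILO2018 §2 — for qubits (unitary 3-design, Webb arXiv:1510.02769, Zhu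
arXiv:1510.02619: the card's rank-n/2 projector orbit is parity-dead), qutrits and every p alike;
group averaging is never free here. PROOF PLAN: (1) ORBIT BOUND (elementary): for a term L with Weyl
support supp(L) ⊂ F_p^{2k}, W := span supp(L), W_0 := span(supp − supp), the μ_3-stabiliser K ≤
C/scalars has K ∩ (translations) = -/
@[route_item "route-MatrixMultiplication-WaringApolarity"]
def ECliffordOrbitFloor : Prop :=
  ∀ p : ℕ, p.Prime → ∃ c : ℝ, 0 < c ∧ ∀ (k r : ℕ) (L : Fin r → Matrix (Fin k → Fin p) (Fin k → Fin p) ℂ), 1 ≤ k → (∀ U : GL (Fin k → Fin p) ℂ, (∀ a b : Fin k → Fin p, ∃ (a' b' : Fin k → Fin p) (s : ℂ), (U : Matrix (Fin k → Fin p) (Fin k → Fin p) ℂ) * (Matrix.of fun x y : Fin k → Fin p => if x = y + a then Complex.exp (2 * (Real.pi : ℂ) * Complex.I * (∑ l : Fin k, ((b l : ℕ) : ℂ) * ((y l : ℕ) : ℂ)) / (p : ℂ)) else 0) * ((U⁻¹ : GL (Fin k → Fin p) ℂ) : Matrix (Fin k → Fin p) (Fin k → Fin p) ℂ) = s • (Matrix.of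 fun x y : Fin k → Fin p => if x = y + a' then Complex.exp (2 * (Real.pi : ℂ) * Complex.I * (∑ l : Fin k, ((b' l : ℕ) : ℂ) * ((y l : ℕ) : ℂ)) / (p : ℂ)) else 0)) → ∀ i : Fin r, ∃ (i' : Fin r) (ζ : ℂ), ζ ^ 3 = 1 ∧ (U : Matrix (Fin k → Fin p) (Fin k → Fin p) ℂ) * L i * ((U⁻¹ : GL (Fin k → Fin p) ℂ) : Matrix (Fin k → Fin p) (Fin k → Fin p) ℂ) = ζ • L i') → (∀ A : Matrix (Fin k → Fin p) (Fin k → Fin p) ℂ, (A ^ 3).trace = ∑ i, ((L i * A).trace) ^ 3) → c * ((p : ℝ) ^ k) ^ 4 ≤ (r : ℝ)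

-- earlier Assembly (stmt-MatrixMultiplication-0617, replaced 2026-08-15T16:17:50Z -> stmt-MatrixMultiplication-10520): retired by None — (∀ ε : ℝ, 0 < ε → (fun n : ℕ => ((sInf {r : ℕ | ∃ (L : Fin r → Matrix (Fin n) (Fin n) ℂ), ∀ A : Matrix (Fin n) (Fin n) ℂ, (A ^ 3).trace = ∑ i, ((L i * A).trace) ^ 3} : ℕ) : ℝ)) =O[Filter.atTop] fun n : ℕ => (n : ℝ) ^ (2 + ε)) → MatrixMultiplication
/-- item stmt-MatrixMultiplication-10520 · assembly · rank 1 · open · by planner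
Frame item #1 (X → Statement), BY NAME: the Waring-rank thesis EThesis (X_E) implies ω(ℂ) = 2.
Discharged verbatim by the route's proved deciding theorem `closes` (rev 3): ω ≥ 2 is
FlatteningBound.omega_two_le; ω ≤ 2 by contradiction from EThesis at ε = (ω−2)/2 against
WaringRankTrCubeProofs.rpow_omega_le_waringRankTrCube ((n/4)^ω ≤ R_S(sM⟨n⟩), n ≥ 6). A prover closes
it with `fun h => closes h`. -/
@[route_item "route-MatrixMultiplication-WaringApolarity"]
def Assembly : Prop :=
  EThesis → _root_.MatrixMultiplication

/-! D-0027 §2.1 — DECIDING THEOREM (planner-authored via `route open/edit --closes-file`; by planner-rbadge-MatrixMultiplication-WaringApol-21388bfa-g2-0 2026-08-15T16:16:33Z):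
its hypotheses are this route's items and its conclusion the sub-problem Statement (glue_lint), and it elaborates with this file. -/

/-- DECIDING THEOREM (D-0027 §2.1): the Waring-rank thesis `X_E` (`EThesis`, the route's target;
fed by the rank-2 crux `EOrbitDesigns` through the support item `EOrbitDesignsToThesis`) alone
decides the summit `ω(ℂ) = 2`.
`ω(ℂ) ≥ 2` is the flattening bound (`Literature.….omega_two_le`, Bläser 2013 §5–6). For `ω(ℂ) ≤ 2`
suppose `2 < ω` and put `ε := (ω − 2)/2 > 0`; `X_E` at `ε` gives `R_S(sM⟨n⟩) ≤ C·n^{2+ε} = C·n^{ω−ε}`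
for all large `n` (the inlined `sInf` of `EThesis` is `waringRankTrCube n` by `rfl`), while
`(n/4)^ω ≤ R_S(sM⟨n⟩)` for `n ≥ 6` (`Literature.….rpow_omega_le_waringRankTrCube`: Bläser 2013
Thm 5.9 `m^ω ≤ R(⟨m,m,m⟩)` + the CHILO2018 p.5 polarisation bridge `R(⟨m,m,m⟩) ≤ R_S(sM⟨3m⟩)` +
zero-padding monotonicity); hence `n^ε ≤ 4^ω·C` for all large `n`, impossible since `n^ε → ∞`.
Sources: ChiantiniHauensteinIkenmeyerLandsbergOttaviani2018 Thm 1.1 (arXiv:1706.05074); Blaser2013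
Def 5.1, Thm 5.9. -/
@[closes "route-MatrixMultiplication-WaringApolarity"] theorem closes (hE : EThesis) : _root_.MatrixMultiplication := by
  show Literature.Computability.AlgebraicComplexity.omega ℂ = 2
  refine le_antisymm (not_lt.mp fun hω => ?_)
    (Literature.Computability.AlgebraicComplexity.omega_two_le ℂ)
  set ω : ℝ := Literature.Computability.AlgebraicComplexity.omega ℂ with hωdef
  set ε : ℝ := (ω - 2) / 2 with hεdef
  have hε : 0 < ε := by rw [hεdef]; linarith
  obtain ⟨C, hC0, hC⟩ := (hE ε hε).exists_pos
  have hT : Filter.Tendsto (fun n : ℕ => (n : ℝ) ^ ε) Filter.atTop Filter.atTop :=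
    (tendsto_rpow_atTop hε).comp tendsto_natCast_atTop_atTop
  obtain ⟨n, hn6, hnC, hnT⟩ := ((Filter.eventually_ge_atTop 6).and
    (hC.bound.and (hT.eventually_gt_atTop (C * (4 : ℝ) ^ ω)))).exists
  have hn0 : (0 : ℝ) < n := by exact_mod_cast (show 0 < n by omega)
  -- lower frame `(n/4)^ω ≤ R_S(sM⟨n⟩)` (Bläser Thm 5.9 + CHILO2018 p.5 bridge + monotonicity)
  have hlow : ((n : ℝ) / 4) ^ ω ≤
      (Literature.Computability.AlgebraicComplexity.waringRankTrCube n : ℝ) :=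
    Literature.Computability.AlgebraicComplexity.rpow_omega_le_waringRankTrCube hn6
  -- the thesis at `ε`: `R_S(sM⟨n⟩) ≤ C·n^{2+ε}` (the inlined `sInf` IS `waringRankTrCube n`)
  have hnC' : ‖((Literature.Computability.AlgebraicComplexity.waringRankTrCube n : ℕ) : ℝ)‖ ≤
      C * ‖(n : ℝ) ^ (2 + ε)‖ := hnC
  have hup : (Literature.Computability.AlgebraicComplexity.waringRankTrCube n : ℝ) ≤
      C * (n : ℝ) ^ (2 + ε) := by
    rw [Real.norm_natCast, Real.norm_of_nonneg (Real.rpow_nonneg hn0.le _)] at hnC'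
    exact hnC'
  have hnT' : C * (4 : ℝ) ^ ω < (n : ℝ) ^ ε := hnT
  have h4 : (0 : ℝ) < (4 : ℝ) ^ ω := Real.rpow_pos_of_pos (by norm_num) _
  have hpow : (0 : ℝ) < (n : ℝ) ^ (2 + ε) := Real.rpow_pos_of_pos hn0 _
  have hωε : ε + (2 + ε) = ω := by rw [hεdef]; ring
  have hsplit : (n : ℝ) ^ ε * (n : ℝ) ^ (2 + ε) = (n : ℝ) ^ ω := by
    rw [← Real.rpow_add hn0, hωε]
  have h2 := hlow.trans hup
  rw [Real.div_rpow hn0.le (by norm_num : (0 : ℝ) ≤ 4) ω, div_le_iff₀ h4] at h2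
  have key : (n : ℝ) ^ ε * (n : ℝ) ^ (2 + ε) ≤ (C * (4 : ℝ) ^ ω) * (n : ℝ) ^ (2 + ε) := by
    rw [hsplit]
    calc (n : ℝ) ^ ω ≤ C * (n : ℝ) ^ (2 + ε) * (4 : ℝ) ^ ω := h2
      _ = (C * (4 : ℝ) ^ ω) * (n : ℝ) ^ (2 + ε) := by ring
  exact absurd (hnT'.trans_le (le_of_mul_le_mul_right key hpow)) (lt_irrefl _)

end Summit.MatrixMultiplication.MatrixMultiplication.Theses.WaringApolarity
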